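import Mathlib.RingTheory.Valuation.ValuationSubring
import Mathlib.RingTheory.PrincipalIdealDomain
import Mathlib.LinearAlgebra.FreeModule.PID
import Mathlib.RingTheory.Localization.Module
import Mathlib.Topology.Algebra.OpenSubgroup
import Mathlib.LinearAlgebra.Matrix.GeneralLinearGroup.Defs
import Mathlib.LinearAlgebra.Matrix.Basis
import Mathlib.LinearAlgebra.Matrix.ToLin
import Mathlib.Topology.Instances.Matrix
import Mathlib.Topology.Algebra.Monoid
import HarnessLib

/-!
# Compact groups of matrices over a valued field stabilise a lattice

Let `F` be a topological field, `O ⊆ F` an open valuation subring which is a principal ideal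
domain (e.g. the valuation ring of a complete discretely valued field: `ℤ_ℓ ⊆ ℚ_ℓ`,
`O_λ ⊆ K_λ`), `G` a compact topological group and `ρ : G → GL_n(F)` a continuous homomorphism.
Then `ρ` is conjugate to a homomorphism with values in `GL_n(O)`: there is `P ∈ GL_n(F)` with
`P⁻¹ ρ(g) P ∈ GL_n(O)` for all `g ∈ G` (Serre, *Abelian ℓ-adic representations and elliptic
curves* (1968), Ch. I, §1.1, Remark 1: "if `G` is compact there is a lattice of `V` stable under
`G`"; used in Deligne–Serre 1974, 6.12: "Quitte à remplacer `ρ_λ` par une représentation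
isomorphe, on peut supposer que `ρ_λ(G)` est contenu dans `GL₂(Ô_λ)`").

Everything is PROVED. The argument (loc. cit.): `H = ρ⁻¹(GL_n(O))` is an open subgroup of the
compact group `G`, hence of finite index; the `O`-module `L ⊆ Fⁿ` spanned by the columns of all
`ρ(g)`, `g ∈ G`, is `G`-stable, contains `Oⁿ`, and is generated by the columns of the `ρ(gᵢ)`
for a (finite) system of coset representatives `gᵢ`; being finitely generated and torsion-free
over the principal ideal domain `O` it is free, of rank `n` (it spans `Fⁿ` over `F = Frac O`),
and the matrix `P` of a basis conjugates `ρ` into `GL_n(O)`.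

* `Literature.NumberTheory.GaloisRepresentations.mem_range_generalLinearGroup_map_iff`,
  `isOpen_range_generalLinearGroup_map` — the subgroup `GL_n(O) ≤ GL_n(F)` (the range of
  `Matrix.GeneralLinearGroup.map O.subtype`) consists of the `g` with `g, g⁻¹` `O`-integral, and
  is open when `O` is.
* `Literature.NumberTheory.GaloisRepresentations.exists_conj_mem_range_generalLinearGroup_map` —
  the theorem.

## References

* J.-P. Serre, *Abelian ℓ-adic representations and elliptic curves*, Benjamin (1968), Ch. I,
  §1.1, Remark 1.
* P. Deligne, J.-P. Serre, *Formes modulaires de poids 1*, Ann. Sci. ÉNS (4) 7 (1974), 6.12.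
-/

noncomputable section

open scoped MatrixGroups

open Matrix Module

namespace Literature.NumberTheory.GaloisRepresentations

universe u

variable {F : Type u} [Field F] (O : ValuationSubring F) {n : ℕ}

/-! ### The subgroup `GL_n(O) ≤ GL_n(F)` -/

variable {O}

/-- A matrix `g ∈ GL_n(F)` lies in `GL_n(O)` (the range of `GL_n(O) → GL_n(F)`) iff all entries
of `g` and of `g⁻¹` lie in `O`. [folklore] -/
theorem mem_range_generalLinearGroup_map_iff {g : GL (Fin n) F} :
    g ∈ (Matrix.GeneralLinearGroup.map O.subtype).range ↔
      (∀ i j, (g : Matrix (Fin n) (Fin n) F) i j ∈ O) ∧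
        ∀ i j, ((g⁻¹ : GL (Fin n) F) : Matrix (Fin n) (Fin n) F) i j ∈ O := by
  constructor
  · rintro ⟨M, rfl⟩
    refine ⟨fun i j ↦ ?_, fun i j ↦ ?_⟩
    · simp [Matrix.GeneralLinearGroup.map]
    · rw [← map_inv]
      simp [Matrix.GeneralLinearGroup.map]
  · rintro ⟨h1, h2⟩
    let A : Matrix (Fin n) (Fin n) O := Matrix.of fun i j ↦ ⟨_, h1 i j⟩
    let B : Matrix (Fin n) (Fin n) O := Matrix.of fun i j ↦ ⟨_, h2 i j⟩
    have hA : A.map O.subtype = (g : Matrix (Fin n) (Fin n) F) := by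
      ext i j; rfl
    have hB : B.map O.subtype = ((g⁻¹ : GL (Fin n) F) : Matrix (Fin n) (Fin n) F) := by
      ext i j; rfl
    have hinj : Function.Injective (fun M : Matrix (Fin n) (Fin n) O ↦ M.map O.subtype) :=
      fun M N h ↦ Matrix.ext fun i j ↦ O.subtype_injective (congr_fun (congr_fun h i) j)
    have hAB : A * B = 1 := by
      apply hinj
      change (A * B).map O.subtype = (1 : Matrix (Fin n) (Fin n) O).map O.subtype
      rw [Matrix.map_mul, hA, hB, Matrix.map_one O.subtype (map_zero _) (map_one _)]
      exact g.mul_inv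
    have hBA : B * A = 1 := by
      apply hinj
      change (B * A).map O.subtype = (1 : Matrix (Fin n) (Fin n) O).map O.subtype
      rw [Matrix.map_mul, hA, hB, Matrix.map_one O.subtype (map_zero _) (map_one _)]
      exact g.inv_mul
    refine ⟨⟨A, B, hAB, hBA⟩, Units.ext ?_⟩
    exact hA

variable [TopologicalSpace F]

/-- If `O` is open in `F`, then `GL_n(O)` is open in `GL_n(F)` (units topology). [folklore] -/
theorem isOpen_range_generalLinearGroup_map (hO : IsOpen (O : Set F)) :
    IsOpen (((Matrix.GeneralLinearGroup.map (n := Fin n) O.subtype).range :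
      Subgroup (GL (Fin n) F)) : Set (GL (Fin n) F)) := by
  have h : (((Matrix.GeneralLinearGroup.map (n := Fin n) O.subtype).range :
      Subgroup (GL (Fin n) F)) : Set (GL (Fin n) F)) =
      (⋂ i, ⋂ j, {g : GL (Fin n) F | (g : Matrix (Fin n) (Fin n) F) i j ∈ O}) ∩
        ⋂ i, ⋂ j, {g : GL (Fin n) F | ((g⁻¹ : GL (Fin n) F) : Matrix (Fin n) (Fin n) F) i j ∈ O} := by
    ext g
    simp only [SetLike.mem_coe, mem_range_generalLinearGroup_map_iff, Set.mem_inter_iff, Set.mem_iInter,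
      Set.mem_setOf_eq]
  rw [h]
  refine IsOpen.inter (isOpen_iInter_of_finite fun i ↦ isOpen_iInter_of_finite fun j ↦ ?_)
    (isOpen_iInter_of_finite fun i ↦ isOpen_iInter_of_finite fun j ↦ ?_)
  · exact hO.preimage (Units.continuous_val.matrix_elem i j)
  · exact hO.preimage (Units.continuous_coe_inv.matrix_elem i j)

/-! ### Stable lattices -/

section Lattice

variable {G : Type*} [Group G] [TopologicalSpace G] [IsTopologicalGroup G] [CompactSpace G]

omit [TopologicalSpace F] in
/-- The column `j` of `M * N` is `M` applied to the column `j` of `N`. [folklore] -/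
private lemma col_mul (M N : Matrix (Fin n) (Fin n) F) (j : Fin n) :
    (fun i ↦ (M * N) i j) = M *ᵥ fun i ↦ N i j := by
  ext i
  simp [Matrix.mul_apply, Matrix.mulVec, dotProduct]

/-- **Compact groups stabilise a lattice** (Serre, *Abelian ℓ-adic representations*, I.1.1,
Remark 1; Deligne–Serre 1974, 6.12). Let `O` be an open valuation subring of the topological
field `F` which is a principal ideal domain, `G` a compact topological group and
`ρ : G →ₜ* GL_n(F)` continuous. Then there is `P ∈ GL_n(F)` such that `P⁻¹ ρ(g) P ∈ GL_n(O)` for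
every `g ∈ G`. [cite: SerreAbelianLadic1968, Ch. I §1.1, Remark 1] -/
theorem exists_conj_mem_range_generalLinearGroup_map [IsPrincipalIdealRing O]
    (hO : IsOpen (O : Set F)) (ρ : G →ₜ* GL (Fin n) F) :
    ∃ P : GL (Fin n) F, ∀ g : G,
      P⁻¹ * ρ g * P ∈ (Matrix.GeneralLinearGroup.map O.subtype).range := by
  classical
  -- the open subgroup `H = ρ⁻¹(GL_n(O))`, of finite index
  set H : Subgroup G := (Matrix.GeneralLinearGroup.map O.subtype).range.comap ρ.toMonoidHom
    with hHdef
  have hHopen : IsOpen (H : Set G) :=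
    (isOpen_range_generalLinearGroup_map hO).preimage ρ.continuous_toFun
  haveI hfin : Finite (G ⧸ H) := Subgroup.quotient_finite_of_isOpen H hHopen
  -- the lattice `L` spanned by the columns of the `ρ g`
  let col : G × Fin n → (Fin n → F) := fun p i ↦ (ρ p.1 : Matrix (Fin n) (Fin n) F) i p.2
  set L : Submodule O (Fin n → F) := Submodule.span O (Set.range col) with hLdef
  -- `L` is `G`-stable
  have hstab : ∀ (g : G) (x : Fin n → F), x ∈ L →
      (ρ g : Matrix (Fin n) (Fin n) F) *ᵥ x ∈ L := by
    intro g x hx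
    have key : L ≤ L.comap (((ρ g : Matrix (Fin n) (Fin n) F).mulVecLin).restrictScalars O) := by
      rw [hLdef, Submodule.span_le]
      rintro _ ⟨⟨g', j⟩, rfl⟩
      rw [SetLike.mem_coe, Submodule.mem_comap]
      change (ρ g : Matrix (Fin n) (Fin n) F) *ᵥ col ⟨g', j⟩ ∈ L
      refine Submodule.subset_span ⟨⟨g * g', j⟩, ?_⟩
      simp only [col, map_mul, Units.val_mul]
      exact col_mul _ _ j
    exact key hx
  -- `L` contains the standard basis
  have hstd : ∀ j : Fin n, (Pi.single j 1 : Fin n → F) ∈ L := by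
    intro j
    refine Submodule.subset_span ⟨⟨1, j⟩, ?_⟩
    ext i
    simp [col, Matrix.one_apply, Pi.single_apply, eq_comm]
  -- `L` is finitely generated: by the columns of the `ρ gᵢ`, `gᵢ` coset representatives
  have hfg : L.FG := by
    let col₀ : (G ⧸ H) × Fin n → (Fin n → F) := fun p ↦ col ⟨p.1.out, p.2⟩
    refine ⟨(Set.finite_range col₀).toFinset, le_antisymm ?_ ?_⟩
    · rw [Set.Finite.coe_toFinset, Submodule.span_le]
      rintro _ ⟨p, rfl⟩
      exact Submodule.subset_span ⟨⟨p.1.out, p.2⟩, rfl⟩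
    · rw [Set.Finite.coe_toFinset, hLdef, Submodule.span_le]
      rintro _ ⟨⟨g, j⟩, rfl⟩
      -- `g = gᵢ h` with `h ∈ H`
      set q : G ⧸ H := (g : G ⧸ H) with hq
      have hh : q.out⁻¹ * g ∈ H := by
        rw [← QuotientGroup.eq, QuotientGroup.out_eq']
      obtain ⟨hO1, -⟩ := mem_range_generalLinearGroup_map_iff.mp
        (show ρ (q.out⁻¹ * g) ∈ (Matrix.GeneralLinearGroup.map O.subtype).range from hh)
      have hcol : col ⟨g, j⟩ = ∑ k : Fin n,
          (⟨(ρ (q.out⁻¹ * g) : Matrix (Fin n) (Fin n) F) k j, hO1 k j⟩ : O) • col₀ ⟨q, k⟩ := by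
        have hg : g = q.out * (q.out⁻¹ * g) := by group
        ext i
        simp only [col, col₀, Finset.sum_apply, Pi.smul_apply]
        conv_lhs => rw [hg, map_mul, Units.val_mul, Matrix.mul_apply]
        refine Finset.sum_congr rfl fun k _ ↦ ?_
        rw [mul_comm]
        rfl
      rw [SetLike.mem_coe, hcol]
      exact Submodule.sum_mem _ fun k _ ↦ Submodule.smul_mem _ _
        (Submodule.subset_span ⟨⟨q, k⟩, rfl⟩)
  -- `L` is free of finite rank over the PID `O`
  haveI : Module.Finite O L := Module.Finite.iff_fg.mpr hfg
  haveI : IsDomain O := inferInstance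
  haveI : NoZeroSMulDivisors O (Fin n → F) := by
    refine ⟨fun {c x} h ↦ ?_⟩
    by_cases hc : c = 0
    · exact Or.inl hc
    · right
      have h' : (c : F) • x = 0 := h
      exact (smul_eq_zero.mp h').resolve_left (by exact_mod_cast hc)
  obtain ⟨m, b⟩ := Module.basisOfFiniteTypeTorsionFree' (R := O) (M := L)
  -- the basis vectors, in `Fⁿ`
  let b' : Fin m → (Fin n → F) := fun i ↦ (b i : Fin n → F)
  have hli : LinearIndependent F b' := by
    rw [← LinearIndependent.iff_fractionRing O F]
    exact b.linearIndependent.map' L.subtype (Submodule.ker_subtype L)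
  have hLspan : (L : Set (Fin n → F)) ⊆ Submodule.span F (Set.range b') := by
    intro x hx
    have hx' : (⟨x, hx⟩ : L) ∈ Submodule.span O (Set.range b) := by rw [b.span_eq]; trivial
    have himg := Submodule.mem_map_of_mem (f := L.subtype) hx'
    rw [Submodule.map_span, ← Set.range_comp] at himg
    exact Submodule.span_le_restrictScalars O F _ himg
  have hspan : ⊤ ≤ Submodule.span F (Set.range b') := by
    rw [← (Pi.basisFun F (Fin n)).span_eq, Submodule.span_le]
    rintro _ ⟨j, rfl⟩
    rw [SetLike.mem_coe, Pi.basisFun_apply]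
    exact hLspan (hstd j)
  let B : Basis (Fin m) F (Fin n → F) := Basis.mk hli hspan
  obtain rfl : m = n := by
    simpa using (Module.finrank_eq_card_basis B).symm.trans (Module.finrank_fin_fun F)
  -- the change-of-basis matrix `P` (columns `b i`)
  let Pm : Matrix (Fin m) (Fin m) F := (Pi.basisFun F (Fin m)).toMatrix B
  have hPm : ∀ i j, Pm i j = b' j i := fun i j ↦ by
    simp [Pm, Basis.toMatrix_apply, B]
  haveI : Invertible Pm := (Pi.basisFun F (Fin m)).invertibleToMatrix B
  let P : GL (Fin m) F := unitOfInvertible Pm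
  refine ⟨P, fun g ↦ ?_⟩
  -- `ρ g` restricts to an `O`-linear automorphism of `L`
  let φ : G → (L →ₗ[O] L) := fun g ↦
    (((ρ g : Matrix (Fin m) (Fin m) F).mulVecLin).restrictScalars O).restrict
      (p := L) (q := L) fun x hx ↦ hstab g x hx
  have hφ_mul : ∀ g g', φ (g * g') = φ g * φ g' := fun g g' ↦ by
    refine LinearMap.ext fun x ↦ Subtype.ext ?_
    change ((ρ (g * g') : GL (Fin m) F) : Matrix (Fin m) (Fin m) F) *ᵥ (x : Fin m → F) =
      (ρ g : Matrix (Fin m) (Fin m) F) *ᵥ ((ρ g' : Matrix (Fin m) (Fin m) F) *ᵥ (x : Fin m → F))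
    rw [map_mul, Units.val_mul, Matrix.mulVec_mulVec]
  have hφ_one : φ 1 = 1 := by
    refine LinearMap.ext fun x ↦ Subtype.ext ?_
    change ((ρ 1 : GL (Fin m) F) : Matrix (Fin m) (Fin m) F) *ᵥ (x : Fin m → F) = x
    rw [map_one, Units.val_one, Matrix.one_mulVec]
  let A : G → Matrix (Fin m) (Fin m) O := fun g ↦ LinearMap.toMatrix b b (φ g)
  have hA_mul : ∀ g g', A (g * g') = A g * A g' := fun g g' ↦ by
    simp only [A, hφ_mul]; exact LinearMap.toMatrix_mul b (φ g) (φ g')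
  have hA_one : A 1 = 1 := by simp only [A, hφ_one]; exact LinearMap.toMatrix_one b
  let Ag : GL (Fin m) O :=
    ⟨A g, A g⁻¹, by rw [← hA_mul, mul_inv_cancel, hA_one], by rw [← hA_mul, inv_mul_cancel, hA_one]⟩
  -- `ρ g * P = P * A g`
  have hkey : (ρ g : Matrix (Fin m) (Fin m) F) * Pm = Pm * (A g).map O.subtype := by
    ext i j
    have h1 : ((φ g (b j) : L) : Fin m → F) = ∑ k, (A g k j : F) • b' k := by
      have := (b.sum_repr (φ g (b j))).symm
      conv_lhs => rw [this]
      simp only [A, LinearMap.toMatrix_apply, Submodule.coe_sum, Submodule.coe_smul_of_tower, b']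
      rfl
    have h2 : ((φ g (b j) : L) : Fin m → F) = (ρ g : Matrix (Fin m) (Fin m) F) *ᵥ b' j := rfl
    have h3 := congr_fun (h1.symm.trans h2) i
    simp only [Finset.sum_apply, Pi.smul_apply, smul_eq_mul] at h3
    rw [Matrix.mul_apply, Matrix.mul_apply]
    simp only [hPm, Matrix.map_apply]
    rw [Matrix.mulVec, dotProduct] at h3
    rw [← h3]
    exact Finset.sum_congr rfl fun k _ ↦ mul_comm _ _
  refine ⟨Ag, Units.ext ?_⟩
  have hval : ((Matrix.GeneralLinearGroup.map O.subtype Ag : GL (Fin m) F) :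
      Matrix (Fin m) (Fin m) F) = (A g).map O.subtype := rfl
  rw [hval, Units.val_mul, Units.val_mul]
  change (A g).map O.subtype = ⅟Pm * (ρ g : Matrix (Fin m) (Fin m) F) * Pm
  rw [Matrix.mul_assoc, hkey, ← Matrix.mul_assoc, invOf_mul_self, Matrix.one_mul]

end Lattice

end Literature.NumberTheory.GaloisRepresentations
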